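import Mathlib
import Literature.Geometry.Symplectic.JHolomorphicMap

/-!
# The quotient complex structure along a `J`-curve, read through a pencil chart

Helper file for stub `helper_anchorQuotientStructure` of line `Sketch`, crux `TameOrBrodyR4`
(stmt-SmoothPoincare4-7826, route SullivanDual), skeleton v13.

Setting (Gromov's pencil argument on `ℝ⁴`): `Φ (b, ξ) = F b ξ` is a `C^∞` diffeomorphism
`ℂ² → ℝ⁴` with `C^∞` inverse `β`, the anchor map is `bm x = (β x).1` (the parameter `b` of the
pencil member through `x`), and `w : ℂ → ℝ⁴` is a flat-`J`-holomorphic curve. Along `w` put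
`D η = d(bm)_{w η}`, `X η = dΦ_{β (w η)} ∘ inl` (the section `∂Φ/∂b`) and
`jt η = D η ∘ J (w η) ∘ X η : ℂ →L[ℝ] ℂ`, the complex structure induced by `J` on the quotient
line `T ℝ⁴ / T(member) ≅ ℂ`. We prove: `f = bm ∘ w` is `C^∞`; `jt` is `C^∞`;
`jt η ∘ jt η = -id`; `df_η (i v) = jt η (df_η v)` (quasi-holomorphicity); and the chain rule
`df_η = D η ∘ dw_η`. The two algebraic identities rest on `D η ∘ X η = id` (the chain rule on
`bm ∘ Φ = fst`) and on the `J`-invariance of `ker (D η)`: for every `V`,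
`X η (D η V) - V ∈ ker (D η)`, hence `D η (J (X η (D η V))) = D η (J V)`.
Pure calculus and linear algebra.
-/

-- the registered namespace `Summit.SmoothPoincare4.SmoothPoincare4.…` repeats a component
set_option linter.dupNamespace false

noncomputable section

open scoped ContDiff Topology
open Filter Set Metric Literature.Geometry.Symplectic

namespace Summit.SmoothPoincare4.SmoothPoincare4.Cruxes.TameOrBrodyR4.Sketch

/-- Local notation for the model space `ℝ⁴ = EuclideanSpace ℝ (Fin 4)`. -/
local notation "E4" => EuclideanSpace ℝ (Fin 4)

namespace AnchorQuotientStructure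

variable {A B X : Type*} [NormedAddCommGroup A] [NormedSpace ℝ A] [NormedAddCommGroup B]
  [NormedSpace ℝ B] [NormedAddCommGroup X] [NormedSpace ℝ X]

/-- Chain rule on `fst ∘ β ∘ Φ = fst`: if `β (Φ p) = p` for all `p`, with `Φ` and `β`
differentiable, then `d(fst ∘ β)_{Φ p} (dΦ_p (a, 0)) = a`, i.e. `D ∘ X = id` for the anchor
differential `D` and the section `X = dΦ ∘ inl`. -/
theorem fderiv_fst_apply_fderiv_inl {Φ : A × B → X} {β : X → A × B} (hΦ : Differentiable ℝ Φ)
    (hβ : Differentiable ℝ β) (h : ∀ p, β (Φ p) = p) (p : A × B) (a : A) :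
    fderiv ℝ (fun y => (β y).1) (Φ p)
      (((fderiv ℝ Φ p).comp (ContinuousLinearMap.inl ℝ A B)) a) = a := by
  have hbm : Differentiable ℝ (fun y => (β y).1) := hβ.fst
  have hc : HasFDerivAt ((fun y => (β y).1) ∘ Φ)
      ((fderiv ℝ (fun y => (β y).1) (Φ p)).comp (fderiv ℝ Φ p)) p :=
    (hbm (Φ p)).hasFDerivAt.comp p (hΦ p).hasFDerivAt
  have hid : (fun y => (β y).1) ∘ Φ = Prod.fst := funext fun q => by
    simp only [Function.comp_apply, h q]
  rw [hid] at hc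
  have he := DFunLike.congr_fun (hc.unique hasFDerivAt_fst) ((a, 0) : A × B)
  simpa using he

/-- The kernel trick: if `D ∘ X = id` and `ker D` is `Jx`-invariant, then
`D (Jx (X (D V))) = D (Jx V)` for every `V`, because `X (D V) - V ∈ ker D`. -/
theorem apply_J_section {D : X →L[ℝ] A} {Xs : A →L[ℝ] X} {Jx : X →L[ℝ] X}
    (hDX : ∀ a, D (Xs a) = a) (hker : ∀ v, D v = 0 → D (Jx v) = 0) (V : X) :
    D (Jx (Xs (D V))) = D (Jx V) := by
  have h0 : D (Xs (D V) - V) = 0 := by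
    rw [ContinuousLinearMap.map_sub, hDX, sub_self]
  have h1 := hker _ h0
  rwa [ContinuousLinearMap.map_sub, ContinuousLinearMap.map_sub, sub_eq_zero] at h1

/-- Square `-1`: if `D ∘ X = id`, `ker D` is `Jx`-invariant and `Jx ∘ Jx = -id`, then the
induced endomorphism `jt = D ∘ Jx ∘ X` of the quotient satisfies `jt (jt a) = -a`. -/
theorem jt_apply_jt {D : X →L[ℝ] A} {Xs : A →L[ℝ] X} {Jx : X →L[ℝ] X}
    (hDX : ∀ a, D (Xs a) = a) (hker : ∀ v, D v = 0 → D (Jx v) = 0)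
    (hJ2 : ∀ v, Jx (Jx v) = -v) (a : A) :
    (D.comp (Jx.comp Xs)) ((D.comp (Jx.comp Xs)) a) = -a := by
  simp only [ContinuousLinearMap.comp_apply]
  rw [apply_J_section hDX hker, hJ2, ContinuousLinearMap.map_neg, hDX]

/-- Transfer of `Jx` to the quotient: if `D ∘ X = id` and `ker D` is `Jx`-invariant, then
`jt (D V) = D (Jx V)` for the induced endomorphism `jt = D ∘ Jx ∘ X`. -/
theorem jt_apply_eq {D : X →L[ℝ] A} {Xs : A →L[ℝ] X} {Jx : X →L[ℝ] X}
    (hDX : ∀ a, D (Xs a) = a) (hker : ∀ v, D v = 0 → D (Jx v) = 0) (V : X) :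
    (D.comp (Jx.comp Xs)) (D V) = D (Jx V) := by
  simp only [ContinuousLinearMap.comp_apply]
  exact apply_J_section hDX hker V

end AnchorQuotientStructure

/-- (Geo1) the complex structure induced on the quotient line `ℂ = T ℝ⁴ / T(member)` along a
`J`-holomorphic curve `w`, read through the pencil chart: smooth, square `-1`, and the anchor
coordinate `f = fst ∘ β ∘ w` of the curve is quasi-holomorphic for it. -/
theorem helper_anchorQuotientStructure (J : E4 → E4 →L[ℝ] E4) (hJs : ContDiff ℝ ∞ J)
    (hJ2 : ∀ x v, J x (J x v) = -v)
    (F : ℂ → ℂ → E4) (hF1 : ContDiff ℝ ∞ (fun p : ℂ × ℂ => F p.1 p.2))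
    (β : E4 → ℂ × ℂ) (hβ : ContDiff ℝ ∞ β) (hl : ∀ p : ℂ × ℂ, β (F p.1 p.2) = p)
    (hr : ∀ x, F (β x).1 (β x).2 = x)
    (hkerJ : ∀ x v, fderiv ℝ (fun y => (β y).1) x v = 0 →
      fderiv ℝ (fun y => (β y).1) x (J x v) = 0)
    (w : ℂ → E4) (hw : ContDiff ℝ ∞ w) (hwJ : IsJHolomorphicFlat J w) :
    ContDiff ℝ ∞ (fun η => (β (w η)).1) ∧
    ContDiff ℝ ∞ (fun η => (fderiv ℝ (fun y => (β y).1) (w η)).comp ((J (w η)).comp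
      ((fderiv ℝ (fun p : ℂ × ℂ => F p.1 p.2) (β (w η))).comp (ContinuousLinearMap.inl ℝ ℂ ℂ)))) ∧
    (∀ η v, ((fderiv ℝ (fun y => (β y).1) (w η)).comp ((J (w η)).comp
      ((fderiv ℝ (fun p : ℂ × ℂ => F p.1 p.2) (β (w η))).comp (ContinuousLinearMap.inl ℝ ℂ ℂ))))
      (((fderiv ℝ (fun y => (β y).1) (w η)).comp ((J (w η)).comp
      ((fderiv ℝ (fun p : ℂ × ℂ => F p.1 p.2) (β (w η))).comp (ContinuousLinearMap.inl ℝ ℂ ℂ)))) v)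
      = -v) ∧
    (∀ η v, fderiv ℝ (fun η => (β (w η)).1) η (Complex.I * v) =
      ((fderiv ℝ (fun y => (β y).1) (w η)).comp ((J (w η)).comp
      ((fderiv ℝ (fun p : ℂ × ℂ => F p.1 p.2) (β (w η))).comp (ContinuousLinearMap.inl ℝ ℂ ℂ))))
      (fderiv ℝ (fun η => (β (w η)).1) η v)) ∧
    (∀ η v, fderiv ℝ (fun η => (β (w η)).1) η v =
      fderiv ℝ (fun y => (β y).1) (w η) (fderiv ℝ w η v)) := by
  -- differentiability of the chart `Φ`, of its inverse `β`, of the anchor map and of the curve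
  have hΦd : Differentiable ℝ (fun p : ℂ × ℂ => F p.1 p.2) := hF1.differentiable (by simp)
  have hβd : Differentiable ℝ β := hβ.differentiable (by simp)
  have hbmd : Differentiable ℝ (fun y => (β y).1) := hβd.fst
  have hwd : Differentiable ℝ w := hw.differentiable (by simp)
  -- the key identity `D η ∘ X η = id` (chain rule on `bm ∘ Φ = fst` at `β (w η)`)
  have hDX : ∀ η (a : ℂ), fderiv ℝ (fun y => (β y).1) (w η)
      (((fderiv ℝ (fun p : ℂ × ℂ => F p.1 p.2) (β (w η))).comp
        (ContinuousLinearMap.inl ℝ ℂ ℂ)) a) = a := by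
    intro η a
    have h := AnchorQuotientStructure.fderiv_fst_apply_fderiv_inl hΦd hβd hl (β (w η)) a
    rwa [hr (w η)] at h
  -- the chain rule for `f = bm ∘ w`
  have h5 : ∀ η v, fderiv ℝ (fun η => (β (w η)).1) η v =
      fderiv ℝ (fun y => (β y).1) (w η) (fderiv ℝ w η v) := by
    intro η v
    have hc : HasFDerivAt (fun η => (β (w η)).1)
        ((fderiv ℝ (fun y => (β y).1) (w η)).comp (fderiv ℝ w η)) η :=
      (hbmd (w η)).hasFDerivAt.comp η (hwd η).hasFDerivAt
    rw [hc.fderiv, ContinuousLinearMap.comp_apply]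
  have h1 : ContDiff ℝ ∞ (fun η => (β (w η)).1) := hβ.fst.comp hw
  refine ⟨h1, ?_, ?_, ?_, h5⟩
  · -- smoothness of `jt = D ∘ (J ∘ w) ∘ X`, a composition of three smooth families
    have hP : ContDiff ℝ ∞ (fderiv ℝ (fun p : ℂ × ℂ => F p.1 p.2)) :=
      (contDiff_infty_iff_fderiv.1 hF1).2
    have hD : ContDiff ℝ ∞ (fderiv ℝ (fun y => (β y).1)) :=
      (contDiff_infty_iff_fderiv.1 hβ.fst).2
    have g₁ : ContDiff ℝ ∞ (fun η => fderiv ℝ (fun y => (β y).1) (w η)) := hD.comp hw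
    have g₂ : ContDiff ℝ ∞ (fun η => J (w η)) := hJs.comp hw
    have g₃ : ContDiff ℝ ∞ (fun η => (fderiv ℝ (fun p : ℂ × ℂ => F p.1 p.2) (β (w η))).comp
        (ContinuousLinearMap.inl ℝ ℂ ℂ)) :=
      (hP.comp (hβ.comp hw)).clm_comp contDiff_const
    exact g₁.clm_comp (g₂.clm_comp g₃)
  · -- square `-1`, by the kernel trick
    intro η v
    exact AnchorQuotientStructure.jt_apply_jt (hDX η) (hkerJ (w η)) (hJ2 (w η)) v
  · -- quasi-holomorphicity of `f`, by the chain rule, `J`-holomorphicity of `w` and the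
    -- kernel trick
    intro η v
    rw [h5 η (Complex.I * v), h5 η v, (isJHolomorphicFlat_iff.1 hwJ) η v]
    exact (AnchorQuotientStructure.jt_apply_eq (hDX η) (hkerJ (w η)) (fderiv ℝ w η v)).symm

end Summit.SmoothPoincare4.SmoothPoincare4.Cruxes.TameOrBrodyR4.Sketch
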